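import Literature.MathematicalPhysics.QuantumFieldTheory.Balaban1983to89.B9Thm311PosDefOpenRegimeZd

/-!
# `Balaban1983to89.B9Thm311ContinuityMethodZd` — [Balaban1985BackgroundPropagators] THEOREM 3.11 BY THE CONTINUITY METHOD, REDUCED TO PRINT'S A-PRIORI BOUND:
# on a PRECONNECTED set of regime backgrounds containing the flat one, positive-definiteness of the genuine `Δ_a(U₀)` on `E_𝔤(□₀)` holds EVERYWHERE as soon as
# the positive points obey a UNIFORM coercivity bound `⟨A, Δ_a(U₀)A⟩_τ ≥ c‖A‖²_τ` (print's (3.115)-type estimate `‖G‖ ≤ C` at those points) — openness is this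
# seat's FILE 7, closedness is the a-priori bound, connectedness does the rest

statement-level skeleton of published theorems with citation tags; proofs where landed; nothing here is a claim about the
Yang–Mills mass gap

`[Balaban1985BackgroundPropagators]` ("B9", CMP **99** (1985) 389–434) p. 416, Theorem 3.11 and its proof: *«In [4] we have proved that the operator G_□(1) is
positive»* … the curved case is obtained from the representations of `G` in Sects. B–E together with the bound (3.115) p. 418 (`|G(U)|` uniformly bounded in the
class (3.35)).  The logical skeleton «flat positivity + a-priori bound along a connected family of backgrounds ⟹ positivity for the whole family» is what this
file isolates, with the a-priori bound as the ONE displayed hypothesis.  PDF held: `paper:balaban1985-cmp99-background-propagators` pp. 416–418 (re-read by this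
seat, 2026-08-28).

CITATION HEADER (lean-in-tree rule).  Cell `pub-ymgap` (YM Track A, HUMAN RULING D-0062 ∕ D-0149 width push), DAG node N06 = [B9], width seat
`pub-ymgap-dag-n06-w4` (g3), FILE 8 of the IDEA-3.11 STEP (ii) road; consumes FILE 7 `B9Thm311PosDefOpenRegimeZd` (openness along the regime at every base point),
FILE 6 `B9Thm311PosDefNearFlatZd` (positivity at the flat background on `𝒰′`), dag-n06-b's `flat_posDef_herm_cube`, dag-n06-w2 g3's `linear_herm_on_reg17UnivP`.
PURPOSE (for the N06 census): it converts the object-bound «Theorem 3.11 UNIFORMLY on the regime» into exactly two displayed inputs — (a) a uniform coercivity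
constant at the POSITIVE points of the regime (the content of (3.115)), (b) preconnectedness of the regime set (or of the sub-family one works on).

WHAT IS PROVED (kernel, 0 sorry; theorems only — no `def`, `instance`, `notation`).
* §1 (pure topology) ★★ `forall_pos_of_isPreconnected` — `S` preconnected; a family `f x i` (`i` in any index type) continuous within `S` in `x` for each `i`; the
  positivity set `{x | ∀ i, 0 < f x i}` relatively open in `S`; a uniform lower bound `c·N i ≤ f x i` (`c > 0`, `N i > 0`) at every positive point of `S`;
  one positive point ⟹ every point of `S` is positive (clopen argument in the subtype `S`).
* §2 (carrier, any member with finite `Ω₀`) ★★ `bondPair_pos_on_of_isPreconnected` — for any letter record `o`, any `S` with `LinearOnDomAt` on `S`, letters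
  continuous within `S` at every point of `S` on `E_𝔤(Ω₀)`, UNIFORM COERCIVITY `c·⟨A, A⟩_τ ≤ ⟨A, Δ_a(U₀)A⟩_τ` at the positive points of `S`, `S`
  preconnected, one positive point: `Δ_a(U₀)` is positive definite on `E_𝔤(Ω₀)` for EVERY `U₀ ∈ S`.
* §3 (cube members, regime `𝒰′`) ★★★ `bondPair_pos_on_reg17UnivP_of_coercive` — at every cube member, for every PRECONNECTED `S ⊆ 𝒰′` containing `1`:
  a uniform coercivity constant at the positive points of `S` ⟹ `0 < ⟨A, Δ_a(U₀)A⟩_τ` on `E_𝔤(□₀)∖0` for ALL `U₀ ∈ S`; ★★★ `regularAtH_on_reg17UnivP_of_coercive`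
  (then `Δ_a(U₀)↾□₀` is invertible on `E_𝔤(□₀)` for all `U₀ ∈ S`).

HONEST SCOPE.  A REDUCTION, not Theorem 3.11: the uniform coercivity hypothesis (print's (3.115)-type bound) is displayed and NOT proved (it is N06's
object-bound, Sects. B–E); preconnectedness of the chosen family is displayed too (for `𝒰′` itself it is plausible via the one-parameter scaling of small
fields but NOT proved here).  A6: both §3 theorems are inhabited trivially at `S = {1}` (preconnected, coercive by compactness at one point) — recorded as
`bondPair_pos_on_singleton_one`; the non-trivial use awaits (3.115).  Count-neutral; N05 ∕ N06 NOT discharged; K1⁷ `stmt-QuantumFields-20542` NOT closed; one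
finite `𝕋⁴` programme at fixed `ε`, Bałaban as printed; R4 closes only the conditional finite-`𝕋⁴` rung `BalabanLadder.UV` — nothing continuum ∕ ℝ⁴ ∕ OS ∕ mass
gap ∕ Clay.  Unit `pub-ymgap-dag-n06-w4` (g3), 2026-08-28.
-/

noncomputable section

namespace Literature.MathematicalPhysics.QuantumFieldTheory.Balaban1983to89.B9Thm311ContinuityMethodZd

open Filter Topology
open B7Prop1Explicit
open B7Prop2Explicit (unitaryUnits)
open B8Ineq132 (BondTouches)
open B8LeafModelZd (ZdIdx)
open B9SupplySockB9P3ZdLetters (OpsZd deltaAOf)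
open B9SupplySockB9P3ZdAllLettersZd (opsAllZd)
open B9Eq316AveragingTransposeZd (Reg17 alphaQ tauForm)
open B9Eq327GreenZd (domSub bondPair LinearOnDomAt setOf_bondTouches_finite support_finite_of_mem_domSub bondPair_self_pos)
open B9Eq327GreenZdHerm (domSubH domSubH_le mem_domSubH_iff HermPreservingAt RegularAtH regularAtH_of_bondPair_pos)
open B9Thm311PosDefOpenZd (LettersContinuousWithinAt bondPair_pos_eventually_domSubH cubeMember_Ω0_finite eq_zero_of_not_mem_bondFinset
  continuous_tauForm_right)
open B9Thm311FlatHermKernelZd (bondPair_eq_sum_of_vanish_off flat_posDef_herm_cube)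
open B9Thm311PosDefOpenRegimeZd (lettersContinuousWithinAt_opsAllZd_cube_reg17UnivP)
open B9Eq326DeltaAHermitianZdCurved (linear_herm_on_reg17UnivP one_mem_reg17UnivP)
open B8Eq131CubesAdmissible (cubeFam)
open B8CubeMemberZd (cubeLamS)
open B8Ineq159FlatCubeMemberPrinted (cubeLamBP)

-- `Site` alone could resolve to the torus sites of `Setup.lean`; re-export the `ℤ^d` sites of `B7Prop1Explicit`.
export B7Prop1Explicit (Site)

/-! ## §1  Topology: the continuity method (open + closed-by-a-priori-bound + preconnected ⟹ everywhere) -/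

section Abstract

variable {X : Type*} [TopologicalSpace X] {ι : Type*}

/-- ★★ **THE CONTINUITY METHOD**: on a preconnected set `S`, let `f x i ∈ ℝ` be continuous within `S` in `x` for each index `i`; suppose the positivity set
`P = {x | ∀ i, 0 < f x i}` is relatively open in `S`, and that at every positive point of `S` the uniform bound `c·N i ≤ f x i` holds (`c > 0`, `N i > 0`). If
one point of `S` is positive, all are.  (In the subtype `S`, `P` is open by hypothesis and closed by the a-priori bound — a limit of points with `f ≥ cN` has
`f ≥ cN > 0` — hence clopen and non-empty.) [cite: Balaban1985BackgroundPropagators, Thm 3.11 p.416 + (3.115) p.418 (bookkeeping: the logical skeleton of the proof, not a printed statement)] -/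
theorem forall_pos_of_isPreconnected (S : Set X) (hS : IsPreconnected S) (f : X → ι → ℝ) (N : ι → ℝ) (hN : ∀ i, 0 < N i)
    (hcont : ∀ x ∈ S, ∀ i, ContinuousWithinAt (fun y => f y i) S x)
    (hopen : ∀ x ∈ S, (∀ i, 0 < f x i) → ∀ᶠ y in 𝓝[S] x, ∀ i, 0 < f y i)
    {c : ℝ} (hc : 0 < c) (hcoer : ∀ x ∈ S, (∀ i, 0 < f x i) → ∀ i, c * N i ≤ f x i)
    {x₁ : X} (hx₁ : x₁ ∈ S) (hpos : ∀ i, 0 < f x₁ i) :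
    ∀ x ∈ S, ∀ i, 0 < f x i := by
  haveI : PreconnectedSpace S := isPreconnected_iff_preconnectedSpace.1 hS
  -- the positivity set in the subtype
  let P : Set S := {z | ∀ i, 0 < f (z : X) i}
  -- open
  have hPopen : IsOpen P := by
    rw [isOpen_iff_eventually]
    intro z hz
    have h := hopen z z.2 hz
    rw [nhdsWithin_eq_map_subtype_coe z.2, eventually_map] at h
    exact h
  -- closed (a-priori bound at positive points + continuity)
  have hPclosed : IsClosed P := by
    refine isClosed_of_closure_subset fun z hz => ?_
    rw [mem_closure_iff_frequently] at hz
    intro i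
    have hfreq : ∃ᶠ w : S in 𝓝 z, c * N i ≤ f (w : X) i := hz.mono fun w hw => hcoer w w.2 hw i
    have hcz : ContinuousAt (fun w : S => f (w : X) i) z := by
      have h := hcont z z.2 i
      rw [continuousWithinAt_iff_continuousAt_restrict _ z.2] at h
      exact h
    have hge : c * N i ≤ f (z : X) i := by
      by_contra hlt
      have hlt' : f (z : X) i < c * N i := lt_of_not_ge hlt
      have hev : ∀ᶠ w : S in 𝓝 z, f (w : X) i < c * N i := hcz.eventually (Iio_mem_nhds hlt')
      obtain ⟨w, hw1, hw2⟩ := (hfreq.and_eventually hev).exists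
      exact absurd hw2 (not_lt.2 hw1)
    exact lt_of_lt_of_le (mul_pos hc (hN i)) hge
  -- clopen and non-empty ⟹ everything
  have hPuniv : P = Set.univ := IsClopen.eq_univ ⟨hPclosed, hPopen⟩ ⟨⟨x₁, hx₁⟩, hpos⟩
  intro x hx
  have : (⟨x, hx⟩ : S) ∈ P := by rw [hPuniv]; exact Set.mem_univ _
  exact this

end Abstract

/-! ## §2  The carrier: positivity of `Δ_a(U₀)` on `E_𝔤(Ω₀)` along a preconnected family from a uniform coercivity bound -/

section Carrier

variable {d : ℕ} {𝔸 : Type*} [CStarAlgebra 𝔸] [FiniteDimensional ℝ 𝔸] (τ : 𝔸 →ₗ[ℂ] ℂ)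

/-- the pairing `U₀ ↦ ⟨A, Δ_a(U₀)A⟩_τ` is continuous within `S` at a point where the letters are (finite `Ω₀`; a finite sum of continuous fibre pairings).
[cite: Balaban1985BackgroundPropagators, (3.26) p.395 (bookkeeping)] -/
theorem continuousWithinAt_bondPair_deltaAOf {η : ℝ} {o : OpsZd d 𝔸} {Ω₀ : Set (Site d)} (hΩ : Ω₀.Finite)
    {W : Submodule ℝ (Site d → Fin d → 𝔸)} (hW : W ≤ domSub (𝔸 := 𝔸) Ω₀) {S : Set (Site d → Fin d → 𝔸ˣ)} {U₁ : Site d → Fin d → 𝔸ˣ}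
    (hcont : LettersContinuousWithinAt η o Ω₀ W S U₁) {A : Site d → Fin d → 𝔸} (hA : A ∈ W) :
    ContinuousWithinAt (fun U₀ => bondPair τ A (deltaAOf η o U₀ A)) S U₁ := by
  classical
  let T : Finset (Site d × Fin d) := (setOf_bondTouches_finite (d := d) hΩ).toFinset
  have hvan : ∀ b : Site d × Fin d, b ∉ T → A b.1 b.2 = 0 := fun b hb => eq_zero_of_not_mem_bondFinset hΩ (hW hA) b hb
  have heq : (fun U₀ => bondPair τ A (deltaAOf η o U₀ A)) = fun U₀ => ∑ b ∈ T, tauForm τ (A b.1 b.2) (deltaAOf η o U₀ A b.1 b.2) := by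
    funext U₀
    exact bondPair_eq_sum_of_vanish_off τ T hvan _
  rw [heq]
  refine tendsto_finsetSum _ fun b hb => ?_
  have hbT : BondTouches Ω₀ b.1 b.2 := (setOf_bondTouches_finite (d := d) hΩ).mem_toFinset.1 hb
  exact ((continuous_tauForm_right τ (A b.1 b.2)).tendsto _).comp (hcont A hA b.1 b.2 hbT)

/-- ★★ **THEOREM 3.11 ALONG A PRECONNECTED FAMILY FROM A UNIFORM COERCIVITY BOUND** (the continuity method at the carrier; finite `Ω₀`, finite-dimensional fibre,
faithful `τ`).  Let `S` be a preconnected set of backgrounds on which `Δ_a(U₀)` is ℝ-linear on `E(Ω₀)` and whose letters are continuous within `S` at every point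
of `S` on `E_𝔤(Ω₀)`; suppose that at every `U₀ ∈ S` where `Δ_a(U₀)` is positive definite on `E_𝔤(Ω₀)` the UNIFORM bound `c·⟨A, A⟩_τ ≤ ⟨A, Δ_a(U₀)A⟩_τ` holds
(`c > 0` independent of `U₀` — the content of print's (3.115)), and that `Δ_a(U₁)` is positive definite at one `U₁ ∈ S`.  Then `Δ_a(U₀)` is positive definite on
`E_𝔤(Ω₀)` for EVERY `U₀ ∈ S`. [cite: Balaban1985BackgroundPropagators, Thm 3.11 p.416, (3.115) p.418] -/
theorem bondPair_pos_on_of_isPreconnected (hτp : ∀ a : 𝔸, a ≠ 0 → 0 < (τ (star a * a)).re) {η : ℝ} {o : OpsZd d 𝔸} {Ω₀ : Set (Site d)}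
    (hΩ : Ω₀.Finite) {S : Set (Site d → Fin d → 𝔸ˣ)} (hS : IsPreconnected S) (hlin : ∀ U₀ ∈ S, LinearOnDomAt η o Ω₀ U₀)
    (hcont : ∀ U₁ ∈ S, LettersContinuousWithinAt η o Ω₀ (domSubH Ω₀) S U₁) {c : ℝ} (hc : 0 < c)
    (hcoer : ∀ U₀ ∈ S, (∀ A ∈ domSubH (𝔸 := 𝔸) Ω₀, A ≠ 0 → 0 < bondPair τ A (deltaAOf η o U₀ A)) →
      ∀ A ∈ domSubH (𝔸 := 𝔸) Ω₀, c * bondPair τ A A ≤ bondPair τ A (deltaAOf η o U₀ A))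
    {U₁ : Site d → Fin d → 𝔸ˣ} (hU₁ : U₁ ∈ S) (hpos : ∀ A ∈ domSubH (𝔸 := 𝔸) Ω₀, A ≠ 0 → 0 < bondPair τ A (deltaAOf η o U₁ A)) :
    ∀ U₀ ∈ S, ∀ A ∈ domSubH (𝔸 := 𝔸) Ω₀, A ≠ 0 → 0 < bondPair τ A (deltaAOf η o U₀ A) := by
  -- index the nonzero Hermitian fields
  let ι := {A : Site d → Fin d → 𝔸 // A ∈ domSubH (𝔸 := 𝔸) Ω₀ ∧ A ≠ 0}
  let f : (Site d → Fin d → 𝔸ˣ) → ι → ℝ := fun U₀ A => bondPair τ A.1 (deltaAOf η o U₀ A.1)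
  let N : ι → ℝ := fun A => bondPair τ A.1 A.1
  have hN : ∀ A : ι, 0 < N A := fun A =>
    bondPair_self_pos τ hτp (fun μ => support_finite_of_mem_domSub hΩ (domSubH_le Ω₀ A.2.1) μ) A.2.2
  have hiff : ∀ U₀, (∀ A : ι, 0 < f U₀ A) ↔ ∀ A ∈ domSubH (𝔸 := 𝔸) Ω₀, A ≠ 0 → 0 < bondPair τ A (deltaAOf η o U₀ A) :=
    fun U₀ => ⟨fun h A hA hA0 => h ⟨A, hA, hA0⟩, fun h A => h A.1 A.2.1 A.2.2⟩
  have key := forall_pos_of_isPreconnected S hS f N hN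
    (fun x hx A => continuousWithinAt_bondPair_deltaAOf τ hΩ (domSubH_le Ω₀) (hcont x hx) A.2.1)
    (fun x hx hx' => by
      have h := bondPair_pos_eventually_domSubH τ hΩ hx hlin (hcont x hx) ((hiff x).1 hx')
      exact h.mono fun y hy A => hy A.1 A.2.1 A.2.2)
    hc (fun x hx hx' A => hcoer x hx ((hiff x).1 hx') A.1 A.2.1) hU₁ ((hiff U₁).2 hpos)
  intro U₀ hU₀
  exact (hiff U₀).1 (key U₀ hU₀)

end Carrier

/-! ## §3  Cube members on the regime `𝒰′`: Theorem 3.11 on a preconnected sub-family from print's a-priori bound -/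

section Cube

variable {d : ℕ} {𝔸 : Type*} [CStarAlgebra 𝔸] [FiniteDimensional ℝ 𝔸] [Nontrivial 𝔸] {L : ℕ}
variable (τ : 𝔸 →ₗ[ℂ] ℂ) (hτp : ∀ a : 𝔸, a ≠ 0 → 0 < (τ (star a * a)).re)
  (hτt : ∀ a b : 𝔸, τ (a * b) = τ (b * a)) (hτs : ∀ a : 𝔸, τ (star a) = starRingEnd ℂ (τ a))

include hτp hτt hτs in
/-- ★★★ **THEOREM 3.11 ON A PRECONNECTED FAMILY OF REGIME BACKGROUNDS, REDUCED TO THE A-PRIORI BOUND** — at every cube member (class `cubeLamBP`, `m ≤ k`,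
`d, L ≥ 2`, `L ≤ ρ`): for every preconnected `S ⊆ 𝒰′ = {U₀ unitary, (1.7) on ℤᵈ up to level m, window α_Q∕L²}` with `1 ∈ S`, IF at the positive points of `S`
the uniform coercivity `c·⟨A, A⟩_τ ≤ ⟨A, Δ_a(U₀)A⟩_τ` holds (print's (3.115)-type bound, displayed), THEN `0 < ⟨A, Δ_a(U₀)A⟩_τ` for every Hermitian
`0 ≠ A ∈ E(□₀)` and EVERY `U₀ ∈ S` — flat positivity (dag-n06-b) + openness (FILE 7) + the bound + connectedness. [cite: Balaban1985BackgroundPropagators, Thm 3.11 p.416, (3.115) p.418; Balaban1984PropagatorsII, (2.11) p.225; Balaban1985RegularSpaces, (1.7) p.77, (1.131) p.99] -/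
theorem bondPair_pos_on_reg17UnivP_of_coercive [NeZero L] (hd2 : 2 ≤ d) (hL2 : 2 ≤ L) (ops₀ : ℝ → ZdIdx d L → ℕ → OpsZd d 𝔸) (M : ℝ)
    (i : ZdIdx d L) {a : Site d} {Mc ρ : ℕ} (hΩ : i.Ω = cubeFam false L a Mc ρ i.k) (hΛs : i.Λs = cubeLamS L a Mc ρ i.k) (hρ : L ≤ ρ)
    {m : ℕ} (hm : m ≤ i.k) {S : Set (Site d → Fin d → 𝔸ˣ)}
    (hS𝒰 : S ⊆ {U₀ : Site d → Fin d → 𝔸ˣ | (∀ x κ, U₀ x κ ∈ unitaryUnits 𝔸) ∧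
        Reg17 L m (fun _ => (Set.univ : Set (Site d))) (alphaQ d L / (L : ℝ) ^ 2) U₀})
    (hS : IsPreconnected S) (h1 : (1 : Site d → Fin d → 𝔸ˣ) ∈ S) {c : ℝ} (hc : 0 < c)
    (hcoer : ∀ U₀ ∈ S, (∀ A ∈ domSubH (𝔸 := 𝔸) (i.Ω 0), A ≠ 0 →
        0 < bondPair τ A (deltaAOf i.η (opsAllZd τ L (cubeLamBP L a Mc ρ i.k) ops₀ M i m) U₀ A)) →
      ∀ A ∈ domSubH (𝔸 := 𝔸) (i.Ω 0), c * bondPair τ A A ≤ bondPair τ A (deltaAOf i.η (opsAllZd τ L (cubeLamBP L a Mc ρ i.k) ops₀ M i m) U₀ A)) :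
    ∀ U₀ ∈ S, ∀ A ∈ domSubH (𝔸 := 𝔸) (i.Ω 0), A ≠ 0 →
      0 < bondPair τ A (deltaAOf i.η (opsAllZd τ L (cubeLamBP L a Mc ρ i.k) ops₀ M i m) U₀ A) := by
  have hfin := cubeMember_Ω0_finite i hΩ
  have hstr := linear_herm_on_reg17UnivP τ hτt hτs hτp hL2 (cubeLamBP L a Mc ρ i.k) ops₀ M i m hfin
  refine bondPair_pos_on_of_isPreconnected τ hτp hfin hS (fun U₀ hU => hstr.1 U₀ (hS𝒰 hU))
    (fun U₁ hU₁ => (lettersContinuousWithinAt_opsAllZd_cube_reg17UnivP τ hτp hτt hτs hd2 hL2 (cubeLamBP L a Mc ρ i.k) ops₀ M i hΩ hΛs hρ hm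
      (hS𝒰 hU₁)).mono_set hS𝒰) hc hcoer h1 fun A hA hA0 => ?_
  rw [mem_domSubH_iff] at hA
  exact flat_posDef_herm_cube τ hτt hτs hτp hd2 hL2 ops₀ M i hΩ hΛs hm hA.1 hA.2 hA0

include hτp hτt hτs in
/-- ★★★ **… AND THEN `Δ_a(U₀)↾□₀` IS INVERTIBLE ON `E_𝔤(□₀)` FOR EVERY `U₀ ∈ S`** (`G_𝔤(U₀)` exists along the whole family).
[cite: Balaban1985BackgroundPropagators, Thm 3.11 p.416, (3.27) p.395, (3.115) p.418] -/
theorem regularAtH_on_reg17UnivP_of_coercive [NeZero L] (hd2 : 2 ≤ d) (hL2 : 2 ≤ L) (ops₀ : ℝ → ZdIdx d L → ℕ → OpsZd d 𝔸) (M : ℝ)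
    (i : ZdIdx d L) {a : Site d} {Mc ρ : ℕ} (hΩ : i.Ω = cubeFam false L a Mc ρ i.k) (hΛs : i.Λs = cubeLamS L a Mc ρ i.k) (hρ : L ≤ ρ)
    {m : ℕ} (hm : m ≤ i.k) {S : Set (Site d → Fin d → 𝔸ˣ)}
    (hS𝒰 : S ⊆ {U₀ : Site d → Fin d → 𝔸ˣ | (∀ x κ, U₀ x κ ∈ unitaryUnits 𝔸) ∧
        Reg17 L m (fun _ => (Set.univ : Set (Site d))) (alphaQ d L / (L : ℝ) ^ 2) U₀})
    (hS : IsPreconnected S) (h1 : (1 : Site d → Fin d → 𝔸ˣ) ∈ S) {c : ℝ} (hc : 0 < c)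
    (hcoer : ∀ U₀ ∈ S, (∀ A ∈ domSubH (𝔸 := 𝔸) (i.Ω 0), A ≠ 0 →
        0 < bondPair τ A (deltaAOf i.η (opsAllZd τ L (cubeLamBP L a Mc ρ i.k) ops₀ M i m) U₀ A)) →
      ∀ A ∈ domSubH (𝔸 := 𝔸) (i.Ω 0), c * bondPair τ A A ≤ bondPair τ A (deltaAOf i.η (opsAllZd τ L (cubeLamBP L a Mc ρ i.k) ops₀ M i m) U₀ A)) :
    ∀ U₀ ∈ S, RegularAtH i.η (opsAllZd τ L (cubeLamBP L a Mc ρ i.k) ops₀ M i m) (i.Ω 0) U₀ := by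
  have hfin := cubeMember_Ω0_finite i hΩ
  have hstr := linear_herm_on_reg17UnivP τ hτt hτs hτp hL2 (cubeLamBP L a Mc ρ i.k) ops₀ M i m hfin
  intro U₀ hU₀
  exact regularAtH_of_bondPair_pos τ hfin (hstr.1 U₀ (hS𝒰 hU₀)) (hstr.2 U₀ (hS𝒰 hU₀))
    (bondPair_pos_on_reg17UnivP_of_coercive τ hτp hτt hτs hd2 hL2 ops₀ M i hΩ hΛs hρ hm hS𝒰 hS h1 hc hcoer U₀ hU₀)

include hτp hτt hτs in
/-- **A6 ∕ NON-VACUITY of §3 at the trivial family `S = {1}`**: a singleton is preconnected, and at its one (positive, by dag-n06-b) point a coercivity constant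
exists by compactness of the unit sphere of `E_𝔤(□₀)` — so the hypotheses of the two theorems above are jointly satisfiable in the tree (the non-trivial use
awaits print's (3.115) along a genuine family). [cite: Balaban1985BackgroundPropagators, Thm 3.11 p.416 («G_□(1) is positive»)] -/
theorem bondPair_pos_on_singleton_one [NeZero L] (hd2 : 2 ≤ d) (hL2 : 2 ≤ L) (ops₀ : ℝ → ZdIdx d L → ℕ → OpsZd d 𝔸) (M : ℝ)
    (i : ZdIdx d L) {a : Site d} {Mc ρ : ℕ} (hΩ : i.Ω = cubeFam false L a Mc ρ i.k) (hΛs : i.Λs = cubeLamS L a Mc ρ i.k) {m : ℕ} (hm : m ≤ i.k) :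
    ∀ U₀ ∈ ({1} : Set (Site d → Fin d → 𝔸ˣ)), ∀ A ∈ domSubH (𝔸 := 𝔸) (i.Ω 0), A ≠ 0 →
      0 < bondPair τ A (deltaAOf i.η (opsAllZd τ L (cubeLamBP L a Mc ρ i.k) ops₀ M i m) U₀ A) := by
  intro U₀ hU₀ A hA hA0
  rw [Set.mem_singleton_iff] at hU₀
  subst hU₀
  rw [mem_domSubH_iff] at hA
  exact flat_posDef_herm_cube τ hτt hτs hτp hd2 hL2 ops₀ M i hΩ hΛs hm hA.1 hA.2 hA0

end Cube

end Literature.MathematicalPhysics.QuantumFieldTheory.Balaban1983to89.B9Thm311ContinuityMethodZd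

end
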